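import Literature.MathematicalPhysics.QuantumFieldTheory.Balaban1983to89.T4Continuum
import Literature.MathematicalPhysics.QuantumFieldTheory.Balaban1983to89.AveragingRT

/-!
# `Balaban1983to89.T4Covariance` — rung (B)+1, torus covariance of the `ε → 0` limit points of the unit-scale averaged
loop variables on ONE four-torus: the TRANSLATION third and the REFLECTION third of `T4Continuum.LimitPointsCovariant`,
PROVED under named intertwining hypotheses on the block averaging (bookkeeping only; nothing open is asserted)

CITATION HEADER (lean-in-tree rule 2026-08-18).  Audit cell `pub-balaban`, scoping sub-cell `t4` (unit `b2b-balaban-pv26-g2`,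
SURGE NODE PROVER #26; cell row T4-COV1.L of `t4/T4-DAG.md`, continuing the LEAN TYPING seat's `T4Continuum` v2, whose
`LEAN-TYPING.md` §2 left "the reflection third … not in v2" and "translations … need the cross-level site embedding … (row
COV1.L)").  Companion to `T4Continuum` (same sources): T. Bałaban, *Renormalization group approach to lattice gauge field
theories. I*, Commun. Math. Phys. **109** (1987) 249–301 [Balaban1987RG1] (0.1) p. 251 (the tori `T^{(j)}`, sites = centres of
cubes), (0.3)–(0.12) pp. 252–254 (blocks `B(y)` and block averaging), and (2.17) p. 269, quoted from the page: "Now consider a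
Euclidean symmetry r of the torus T, preserving the torus T^{(k+1)}. We define generally (rU)(b) = U(rb), rb = r⟨b₋, b₊⟩ =
⟨rb₋, rb₊⟩. (2.17) By their definitions the expressions in (2.1) are invariant with respect to these transformations."; T. Bałaban,
*Propagators and renormalization transformations for lattice gauge theories. I*, Commun. Math. Phys. **95** (1984) 17–40
[Balaban1984PropagatorsI] (1.7) p. 18 (the straight contours of `L` bonds between block centres; tree `AveragingRT.lineSite`,
`AveragingRT.axial`); M. R. Douglas, *Report on the status of the Yang–Mills Millennium Prize Problem* (Clay 2004)
[Douglas2004ClayYM] p. 2 ("invariance under the isometry group of the flat metric").  WHAT IS REPRODUCED: nothing is asserted.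
The two hypotheses on the averaging maps are NAMED `Prop`s used as explicit hypotheses (`AvgTranslEquivariant`,
`AvgReflEquivariant`, the translation / reflection instances of (2.17), exactly parallel to `T4Continuum.AvgPermEquivariant`);
every theorem is [folklore] bookkeeping — lattice-walk combinatorics, pull-back identities, induction over the averaging levels —
over tree theorems quoted BY NAME (`TorusLimitAxioms.expect_translate` / `TorusScheme.limit_translate_invariant`,
`TorusHypercubicSymmetry.IsExpectSymmetry.reflect` / `TorusScheme.limit_symmetry_invariant`, `T4Continuum.avg_limitPoints_permute_invariant`).
No `sorry`, no `axiom`.  VALUE = the covariance clause of the typed rung (B)+1 reduced to two printed-formula checks on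
Bałaban's averaging (cell row COV1.X); NOT progress on any open statement (existence/uniqueness of the limit, let alone the
infinite volume, the mass gap or the Clay problem — `T4Continuum` PAGE 1 DISCLAIMER applies verbatim).

WHAT IS PROVED.  (§3) For every lattice family `F`, every compact gauge group with measurable inversion and every finite-ε data
`D`: `AvgPermEquivariant D → AvgTranslEquivariant D → AvgReflEquivariant D → ∀ g₀, LimitPointsCovariant F (D.scheme g₀)`
(`avg_limitPointsCovariant`) — every subsequential limit functional of the joint expectations of unit-scale averaged loop
variables is invariant under ALL isometries of the unit torus `T₁` acting on labels (translations `(ℤ/ℓℤ)⁴`, coordinate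
permutations, axis reflections), with NO hypothesis on the couplings, the construction or the β-functions; hence the
headline clause `D.limit_torusCovariant'` (and the unprimed form) HOLDS under the three named hypotheses
(`avg_limit_torusCovariant`), and the `SU(2)` headline `YM4TorusContinuumSU2'` of `T4Continuum` §8 REDUCES TO THE SINGLE TARGET
`ym4_torus_continuum_limit_exists'` given measurable, equivariant averagings (`ym4TorusContinuumSU2'_of_exists`; RP was already
proved there for `SU(N)`).  (§4) CONSISTENCY CERTIFICATES: the tree's own block-type averaging `AveragingRT.axial` (parallel
transport along the straight line of `L` bonds between block centres, [Balaban1984PropagatorsI] (1.7)) satisfies BOTH hypothesis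
shapes at every level (`axialAvg_translate`, `axialAvg_creflect`), so the shapes are inhabited by a genuine block averaging and
the cross-level vectors in them are the ones forced by the tree's block geometry `Setup.emb` (`Site.emb_add`, `Site.emb_creflect`).

THE TWO TYPING DECISIONS (cell `DIVERGENCE.md` row D-pv26g2.2).  (1) TRANSLATIONS ACROSS LEVELS: a translation of the coarse
torus `T^{(j+1)}` by `a` is the translation of the fine torus `T^{(j)}` by the vector `L·a` (`Site.scale a`, coordinatewise
`n ↦ L·n : ℤ/N_{j+1} → ℤ/N_j`, well defined because `N_j ∣ L·N_{j+1}` at every `j`, `Params.sitesPerDir_dvd_succ_mul`; it is the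
linear part of the tree's inclusion `Setup.emb`, `n ↦ nL + (L-1)/2`: `emb (y + a) = emb y + scale a`); the hypothesis is
`avg_j (U ∘ τ_{L a}) = (avg_j U) ∘ τ_a` (`AvgTranslEquivariant`), and the unit translation `a ∈ T₁` of a label acts on the fine
lattice `T^{(0)}` of the `K`-th approximation by `L^K·a` (`Site.scaleTo K`).  (2) REFLECTIONS ACROSS LEVELS: with the tree's
CENTRED blocks (`Setup.blockOf` = integer division by `L`, block centres `emb n = nL + (L-1)/2`, [Balaban1987RG1] p. 251 "sites =
centres of cubes") the reflection `x_ρ ↦ -x_ρ` of the labels of `T^{(j)}` (tree `Site.reflect`, a reflection through a lattice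
SITE) does NOT preserve the coarse torus `T^{(j+1)} ⊂ T^{(j)}`: `-emb(n) = emb(-n-1)`, and the block `B(n)` is sent onto a set
meeting two blocks; the reflections "preserving the torus T^{(k+1)}" of (2.17) are the reflections through the CENTRE hyperplanes
of the continuum torus, which in the centred labels of EVERY level read `x_ρ ↦ -x_ρ - 1` (`blockOf (-x-1) = -blockOf x - 1`,
`emb (-n-1) = -emb n - 1`: `Site.emb_creflect`).  Their pull-back on configurations is `GaugeField.creflect ρ U :=
(U.translate (-e_ρ)).reflect ρ` (tree `translate`, `reflect`), the hypothesis is `avg_j (creflect ρ U) = creflect ρ (avg_j U)` at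
every level (`AvgReflEquivariant`), and the label reflection `x_ρ ↦ -x_ρ` of `T₁` used by `T4Continuum.ULoop.reflect` is the centre
reflection followed by the unit translation `+e_ρ` — so the reflection third uses BOTH hypotheses, and is realised on `T^{(0)}` by
the exact symmetry `U ↦ creflect ρ (U ∘ τ_{L^K e_ρ})` (a site reflection composed with a translation).  The naive shape
`avg_j (U.reflect ρ) = (avg_j U).reflect ρ` (the SAME site reflection at levels `j` and `j+1`) is FALSE for block averagings with
centred blocks (already for `AveragingRT.axial`: the reflected line of `c` starts at `-emb(c₋) = emb(-c₋-1) ≠ emb(-c₋)`) and even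
contradicts `Averaging.covariant` for non-trivial `G` — the cell's located OBJECTION O-COV1-1 (GAPS G-t4-COV1-3, `t4/T4-XREAD-COV1.md`;
independently CLAIMS.log t4-lean-g2 2026-08-18T18:49:40Z), which asks for reflections `x_ρ ↦ C_j - x_ρ` with `C_j = L·C_{j+1} + (L-1)`;
the centre reflection used here is the member `C_j = -1` of that family at EVERY level (uniform in `j` and `K`, no range hypothesis
`j + 1 ≤ m + K` needed), it is NOT vacuous — `AveragingRT.axial` satisfies it for every group (`axial_avg_creflect`) — and the
one-step partner `x_ρ ↦ (L-1) - x_ρ` of G-t4-COV1-3 (H4) is the same hypothesis modulo `AvgTranslEquivariant`.  SCOPE (GAPS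
G-t4-COV1-4): like `AvgPermEquivariant`, both hypotheses constrain the TOTAL averaging maps `D.av` of the data; the printed averaging
(0.4), (0.11)–(0.12) is defined on the small-field domain and its total extension is the business of the instance module (cell row
T4-D.L), which must check the four properties for the extension it names (done: tree `BlockAveraging`, the total (0.4) term,
with `FiniteEpsData.avgTranslEquivariant_of_blockAvg` / `avgReflEquivariant_of_blockAvg`).

REVISION LOG.  v1 p178296 (unit b2b-balaban-pv26-g2).  v2 (same unit; DOCFIX V1 of the referee cross-read, cell GAPS C-ref5-15 —
docstring-only, no declaration touched): the (2.17) quotation corrected to the print of p. 269 ("the torus T, preserving"; angle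
brackets `r⟨b₋, b₊⟩ = ⟨rb₋, rb₊⟩` — v1 carried the OCR-layer round brackets), re-read on the render
`…1987-cmp109-rg-I-small-field-p021-x2.png`; the four `(0.1)` tags re-paged to p. 251 (render `-p003-x2.png`); the header range of
(0.3)–(0.12) corrected to pp. 252–254 ((0.12) is printed on p. 254, render `-p006-x2.png`).
-/

noncomputable section

open MeasureTheory Filter Topology
open scoped BigOperators

namespace Literature.MathematicalPhysics.QuantumFieldTheory.Balaban1983to89

/-! ## 0. Lattice vectors across levels ([Balaban1987RG1] (0.1), (0.3)) -/

namespace Params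

/-- `N_j ∣ L · N_{j+1}` at EVERY level (`N_j = L N_{j+1}` in the standing range `j + 1 ≤ m + K`, `N_j = N_{j+1} = 2` beyond):
what makes `n ↦ L·n : ℤ/N_{j+1} → ℤ/N_j` well defined. [folklore] -/
theorem sitesPerDir_dvd_succ_mul (P : Params) (j : ℕ) : P.sitesPerDir j ∣ P.sitesPerDir (j+1) * P.L := by
  rcases Nat.lt_or_ge j (P.m + P.K) with h | h
  · exact dvd_of_eq (P.sitesPerDir_eq_mul_succ (by omega))
  · rw [AveragingRT.sitesPerDir_succ_eq_of_le h]
    exact dvd_mul_right _ _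

end Params

namespace Site

variable {P : Params} {j : ℕ}

/-- Coordinates of the zero vector. [folklore] -/
theorem zero_apply (κ : Fin P.d) : (0 : Site P j) κ = 0 := rfl

/-- Translation commutes with the backward unit step (companion of the tree's `Site.shift_add`). [folklore] -/
theorem unshift_add (x a : Site P j) (μ : Fin P.d) : (x + a).unshift μ = x.unshift μ + a := by
  funext ν
  by_cases h : ν = μ
  · subst h
    rw [add_apply]
    simp only [Site.unshift, Function.update_self, add_apply]
    ring
  · rw [add_apply]
    simp only [Site.unshift, Function.update_of_ne h, add_apply]

/-- `(x - e_μ) + e_μ = x`. [folklore] -/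
theorem shift_unshift (x : Site P j) (μ : Fin P.d) : (x.unshift μ).shift μ = x := by
  funext ν
  by_cases h : ν = μ
  · subst h
    simp only [Site.shift, Site.unshift, Function.update_self, sub_add_cancel]
  · simp only [Site.shift, Site.unshift, Function.update_of_ne h]

/-- `(x + e_μ) - e_μ = x`. [folklore] -/
theorem unshift_shift (x : Site P j) (μ : Fin P.d) : (x.shift μ).unshift μ = x := by
  funext ν
  by_cases h : ν = μ
  · subst h
    simp only [Site.shift, Site.unshift, Function.update_self, add_sub_cancel_right]
  · simp only [Site.shift, Site.unshift, Function.update_of_ne h]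

/-- Reflection of the `ρ`-th axis commutes with backward steps in the other directions. [folklore] -/
theorem unshift_reflect_of_ne (ρ : Fin P.d) (x : Site P j) {μ : Fin P.d} (h : μ ≠ ρ) :
    (x.unshift μ).reflect ρ = (x.reflect ρ).unshift μ := by
  funext κ
  simp only [reflect_apply, unshift_apply, h, Ne.symm h, if_false]
  by_cases h1 : κ = ρ
  · subst h1
    simp [Ne.symm h]
  · simp [h1]

/-- `r_ρ (x - e_ρ) = r_ρ x + e_ρ`. [folklore] -/
theorem unshift_reflect_self (ρ : Fin P.d) (x : Site P j) : (x.unshift ρ).reflect ρ = (x.reflect ρ).shift ρ := by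
  funext κ
  by_cases h : κ = ρ
  · subst h
    simp only [Site.shift, Site.unshift, Site.reflect, Function.update_self]
    ring
  · simp only [Site.shift, Site.unshift, Site.reflect, Function.update_of_ne h]

/-- `x + (-e_ρ) = x - e_ρ` (the vector `-e_ρ` is `(0 : Site).unshift ρ`). [folklore] -/
theorem add_zero_unshift (x : Site P j) (ρ : Fin P.d) : x + (0 : Site P j).unshift ρ = x.unshift ρ := by
  funext κ
  rw [add_apply]
  by_cases h : κ = ρ
  · subst h
    simp only [Site.unshift, Function.update_self, zero_apply]
    ring
  · simp only [Site.unshift, Function.update_of_ne h, zero_apply, add_zero]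

/-- `x + e_ρ` (the vector `e_ρ` is `(0 : Site).shift ρ`). [folklore] -/
theorem add_zero_shift (x : Site P j) (ρ : Fin P.d) : x + (0 : Site P j).shift ρ = x.shift ρ := by
  funext κ
  rw [add_apply]
  by_cases h : κ = ρ
  · subst h
    simp only [Site.shift, Function.update_self, zero_apply]
    ring
  · simp only [Site.shift, Function.update_of_ne h, zero_apply, add_zero]

/-- `-e_ρ + e_ρ = 0`. [folklore] -/
theorem zero_unshift_add_zero_shift (ρ : Fin P.d) : (0 : Site P j).unshift ρ + (0 : Site P j).shift ρ = 0 := by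
  rw [add_zero_shift, shift_unshift]

/-- Casting multiples of `L`: congruent labels mod `N_{j+1}` give equal multiples of `L` mod `N_j` (`N_j ∣ L N_{j+1}`). [folklore] -/
theorem natCast_mul_L_eq_of_modEq (P : Params) (j : ℕ) {x y : ℕ} (h : x ≡ y [MOD P.sitesPerDir (j+1)]) :
    ((x * P.L : ℕ) : ZMod (P.sitesPerDir j)) = ((y * P.L : ℕ) : ZMod (P.sitesPerDir j)) :=
  (ZMod.natCast_eq_natCast_iff _ _ _).mpr ((h.mul_right' P.L).of_dvd (P.sitesPerDir_dvd_succ_mul j))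

/-- THE CROSS-LEVEL SCALING of one coordinate: `n ↦ L·n : ℤ/N_{j+1} → ℤ/N_j` (a coarse lattice vector, measured in fine lattice
units), as an additive homomorphism — the linear part of the tree's inclusion `Setup.emb`, `n ↦ nL + (L-1)/2`. [cite: Balaban1987RG1, (0.1) p.251] -/
def scaleCoord (P : Params) (j : ℕ) : ZMod (P.sitesPerDir (j+1)) →+ ZMod (P.sitesPerDir j) where
  toFun n := ((n.val * P.L : ℕ) : ZMod (P.sitesPerDir j))
  map_zero' := by
    show (((0 : ZMod (P.sitesPerDir (j+1))).val * P.L : ℕ) : ZMod (P.sitesPerDir j)) = 0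
    rw [ZMod.val_zero, zero_mul, Nat.cast_zero]
  map_add' a b := by
    show (((a + b).val * P.L : ℕ) : ZMod (P.sitesPerDir j)) =
      ((a.val * P.L : ℕ) : ZMod (P.sitesPerDir j)) + ((b.val * P.L : ℕ) : ZMod (P.sitesPerDir j))
    rw [← Nat.cast_add, ← add_mul]
    apply natCast_mul_L_eq_of_modEq
    rw [ZMod.val_add]
    exact Nat.mod_modEq _ _

/-- `scaleCoord` evaluated. [folklore] -/
theorem scaleCoord_apply (n : ZMod (P.sitesPerDir (j+1))) :
    scaleCoord P j n = ((n.val * P.L : ℕ) : ZMod (P.sitesPerDir j)) := rfl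

/-- `scaleCoord 1 = L`. [folklore] -/
theorem scaleCoord_one : scaleCoord P j 1 = (P.L : ZMod (P.sitesPerDir j)) := by
  rw [scaleCoord_apply, ZMod.val_one, one_mul]

/-- **THE FINE LATTICE VECTOR OF A COARSE TRANSLATION**: `a ↦ L·a : T^{(j+1)} → T^{(j)}` coordinatewise (`scaleCoord`), an additive
homomorphism — translating the coarse torus by `a` is translating the fine torus by `scale a` (`emb_add`). [cite: Balaban1987RG1, (0.1) p.251] -/
def scale : Site P (j+1) →+ Site P j where
  toFun a := fun μ => scaleCoord P j (a μ)
  map_zero' := by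
    funext μ
    show scaleCoord P j ((0 : Site P (j+1)) μ) = (0 : Site P j) μ
    rw [zero_apply, zero_apply, map_zero]
  map_add' a b := by
    funext μ
    show scaleCoord P j ((a + b) μ) = scaleCoord P j (a μ) + scaleCoord P j (b μ)
    rw [add_apply, map_add]

/-- `scale` evaluated. [folklore] -/
theorem scale_apply (a : Site P (j+1)) (μ : Fin P.d) : scale a μ = scaleCoord P j (a μ) := rfl

/-- Block centres in coordinates: `emb y κ = L·y_κ + (L-1)/2` (tree `Setup.emb`). [folklore] -/
theorem emb_apply_eq (y : Site P (j+1)) (κ : Fin P.d) :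
    emb y κ = scaleCoord P j (y κ) + (((P.L - 1) / 2 : ℕ) : ZMod (P.sitesPerDir j)) := by
  show (((y κ).val * P.L + (P.L - 1) / 2 : ℕ) : ZMod (P.sitesPerDir j)) = _
  rw [Nat.cast_add, scaleCoord_apply]

/-- `2·((L-1)/2) + 1 = L` in `ℤ/N_j` (`L` odd; tree `AveragingRT.two_mul_half_add_one`). [folklore] -/
theorem two_mul_half_add_one_cast (P : Params) (j : ℕ) :
    (2 * (((P.L - 1) / 2 : ℕ) : ZMod (P.sitesPerDir j)) + 1 : ZMod (P.sitesPerDir j)) = (P.L : ZMod (P.sitesPerDir j)) := by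
  have h := AveragingRT.two_mul_half_add_one P
  exact_mod_cast congrArg (Nat.cast : ℕ → ZMod (P.sitesPerDir j)) h

/-- **`emb (y + a) = emb y + L·a`**: the tree's inclusion of the coarse torus (block centres, `Setup.emb`) intertwines the coarse
translation by `a` with the fine translation by `scale a` — the cross-level vector is forced. [cite: Balaban1987RG1, (0.1) p.251] -/
theorem emb_add (y a : Site P (j+1)) : emb (y + a) = emb y + scale a := by
  funext μ
  rw [add_apply, emb_apply_eq, emb_apply_eq, add_apply, map_add, scale_apply]
  ring

/-- **`emb (-y - e_ρ) = -(emb y) - e_ρ` (coordinate `ρ`)**: the CENTRE reflection `x_ρ ↦ -x_ρ - 1` of the labels of EVERY level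
preserves the inclusions of the coarser tori (block centres go to block centres) — this, and not `x_ρ ↦ -x_ρ`, is a "Euclidean
symmetry … preserving the torus T^{(k+1)}" of [Balaban1987RG1] (2.17) in the centred labels. [cite: Balaban1987RG1, (2.17) p.269] -/
theorem emb_creflect (ρ : Fin P.d) (y : Site P (j+1)) :
    emb ((y.reflect ρ).unshift ρ) = ((emb y).reflect ρ).unshift ρ := by
  have hL := two_mul_half_add_one_cast P j
  funext κ
  by_cases h : κ = ρ
  · subst h
    simp only [Site.unshift, Site.reflect, Function.update_self, Function.update_idem, emb_apply_eq, map_sub, map_neg,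
      scaleCoord_one]
    linear_combination hL
  · simp only [Site.unshift, Site.reflect, Function.update_of_ne h, emb_apply_eq]

/-- The `k`-fold scaling `T^{(k)} → T^{(0)}`, `a ↦ L^k·a`: the fine-lattice vector of a translation of the `k`-th level. [cite: Balaban1987RG1, (0.1) p.251] -/
def scaleTo : (k : ℕ) → (Site P k →+ Site P 0)
  | 0 => AddMonoidHom.id _
  | k + 1 => (scaleTo k).comp scale

/-- `scaleTo 0 = id`. [folklore] -/
@[simp] theorem scaleTo_zero (b : Site P 0) : scaleTo 0 b = b := rfl

/-- `scaleTo (k+1) = scaleTo k ∘ scale`. [folklore] -/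
theorem scaleTo_succ (k : ℕ) (b : Site P (k+1)) : scaleTo (k+1) b = scaleTo k (scale b) := rfl

end Site

namespace GaugeField

variable {P : Params} {j : ℕ} {G : Type*}

/-- Translation by the zero vector is the identity. [folklore] -/
@[simp] theorem translate_zero (U : GaugeField P j G) : U.translate 0 = U := by
  funext b
  obtain ⟨x, μ⟩ := b
  simp [GaugeField.translate_apply, PBond.translate]

variable [GaugeGroup G]

/-- **THE CENTRE REFLECTION on configurations of `T^{(j)}`**: the pull-back `(rU)(b) = U(rb)` ([Balaban1987RG1] (2.17)) along the
reflection `x_ρ ↦ -x_ρ - 1` of the centred labels (the reflection through the centre hyperplane `{x_ρ = 0}` of the continuum torus,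
which preserves every lattice `T^{(j)}`), i.e. the tree's site reflection `reflect ρ` composed with the translation by `-e_ρ`
(reflected `ρ`-bonds are traversed backwards, as in `GaugeField.reflect`). [cite: Balaban1987RG1, (2.17) p.269] -/
def creflect (ρ : Fin P.d) (U : GaugeField P j G) : GaugeField P j G :=
  (U.translate ((0 : Site P j).unshift ρ)).reflect ρ

/-- `creflect` unfolded. [folklore] -/
theorem creflect_eq (ρ : Fin P.d) (U : GaugeField P j G) :
    U.creflect ρ = (U.translate ((0 : Site P j).unshift ρ)).reflect ρ := rfl

/-- The site reflection is the centre reflection of the translate by `+e_ρ`: `r_ρ = c_ρ ∘ τ_{e_ρ}` on configurations. [folklore] -/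
theorem creflect_translate_shift (ρ : Fin P.d) (U : GaugeField P j G) :
    (U.translate ((0 : Site P j).shift ρ)).creflect ρ = U.reflect ρ := by
  rw [creflect_eq, translate_translate, Site.zero_unshift_add_zero_shift, translate_zero]

end GaugeField

namespace Missing

/-- On the fine lattice `T^{(0)}`, `U ↦ c_ρ (U ∘ τ_s)` (a translation followed by the centre reflection) is an exact symmetry of
the Wilson expectation (tree `IsExpectSymmetry.translate`, `.reflect`, `.comp`). [folklore] -/
theorem IsExpectSymmetry.creflect_translate {G : Type*} [GaugeGroup G] [MeasurableSpace G] [HaarData G] [MeasurableInv G]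
    (P : Params) (β : ℝ) (ρ : Fin P.d) (s : Site P 0) :
    IsExpectSymmetry P β (fun U : GaugeField P 0 G => (U.translate s).creflect ρ) :=
  (IsExpectSymmetry.reflect ρ).comp ((IsExpectSymmetry.translate _).comp (IsExpectSymmetry.translate s))

end Missing

/-! ## 1. Walks, holonomies and iterated averagings under translations and reflections (any level `j`) -/

namespace T4Continuum

open Missing

/-- Axis reflections act on oriented steps: the bond is reflected (`PBond.reflect`); a step in the reflected direction changes
orientation, a step in another direction keeps it (tree `Missing.PathStep.reflect` is the case `j = 0`). [folklore] -/
def LStep.reflect {P : Params} {j : ℕ} (ρ : Fin P.d) (s : LStep P j) : LStep P j :=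
  ⟨s.bond.reflect ρ, if s.bond.dir = ρ then !s.fwd else s.fwd⟩

/-- Translations act on oriented steps through the bond (`PBond.translate`). [folklore] -/
def LStep.translate {P : Params} {j : ℕ} (a : Site P j) (s : LStep P j) : LStep P j :=
  ⟨s.bond.translate a, s.fwd⟩

section WalkLemmas

variable {P : Params} {j : ℕ}

/-- The walk of a word from a translated base is the translated walk. [folklore] -/
theorem walk_translate (a x : Site P j) (w : List (Letter P.d)) :
    walk (x + a) w = (walk x w).map (LStep.translate a) := by
  induction w generalizing x with
  | nil => rfl
  | cons l w ih =>
    obtain ⟨μ, b⟩ := l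
    cases b
    · simp only [walk, List.map_cons, Site.unshift_add, ih]
      rfl
    · simp only [walk, List.map_cons, Site.shift_add, ih]
      rfl

/-- The walk of the reflected word from the reflected base is the reflected walk. [folklore] -/
theorem walk_reflect (ρ : Fin P.d) (x : Site P j) (w : List (Letter P.d)) :
    walk (x.reflect ρ) (w.map (Letter.reflect ρ)) = (walk x w).map (LStep.reflect ρ) := by
  induction w generalizing x with
  | nil => rfl
  | cons l w ih =>
    obtain ⟨μ, b⟩ := l
    by_cases h : μ = ρ
    · subst h
      cases b
      · -- the letter `-e_μ` becomes `+e_μ`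
        simp only [List.map_cons, Letter.reflect, if_true, Bool.not_false, walk]
        rw [← Site.unshift_reflect_self, ih]
        simp [LStep.reflect, PBond.reflect, Site.shift_unshift]
      · -- the letter `+e_μ` becomes `-e_μ`
        simp only [List.map_cons, Letter.reflect, if_true, Bool.not_true, walk]
        rw [← Site.shift_reflect_self, ih]
        simp [LStep.reflect, PBond.reflect]
    · cases b
      · simp only [List.map_cons, Letter.reflect, if_neg h, walk]
        rw [← Site.unshift_reflect_of_ne ρ x h, ih]
        simp [LStep.reflect, PBond.reflect, h]
      · simp only [List.map_cons, Letter.reflect, if_neg h, walk]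
        rw [← Site.shift_reflect_of_ne ρ x h, ih]
        simp [LStep.reflect, PBond.reflect, h]

variable {G : Type*} [GaugeGroup G]

/-- Step variables under the site reflection: the variable of `s` in `r_ρ U` is the variable of `r_ρ s` in `U` (tree
`Missing.stepHol_reflect` is `j = 0`). [folklore] -/
theorem stepVar_reflect (ρ : Fin P.d) (U : GaugeField P j G) (s : LStep P j) :
    (if s.fwd then U.reflect ρ s.bond else (U.reflect ρ s.bond)⁻¹) =
      (if (s.reflect ρ).fwd then U (s.reflect ρ).bond else (U (s.reflect ρ).bond)⁻¹) := by
  obtain ⟨b, f⟩ := s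
  by_cases hd : b.dir = ρ <;> cases f <;> simp [LStep.reflect, GaugeField.reflect_apply, hd]

/-- Holonomy of the reflected configuration along `γ` = holonomy along the reflected steps. [folklore] -/
theorem holAt_reflect (ρ : Fin P.d) (U : GaugeField P j G) (γ : List (LStep P j)) :
    holAt (U.reflect ρ) γ = holAt U (γ.map (LStep.reflect ρ)) := by
  unfold holAt
  rw [List.map_map]
  congr 1
  exact List.map_congr_left fun s _ => stepVar_reflect ρ U s

/-- Holonomy of the translated configuration along `γ` = holonomy along the translated steps. [folklore] -/
theorem holAt_translate (a : Site P j) (U : GaugeField P j G) (γ : List (LStep P j)) :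
    holAt (U.translate a) γ = holAt U (γ.map (LStep.translate a)) := by
  simp only [holAt, List.map_map]
  rfl

/-- The same for the loop variable (reflections). [folklore] -/
theorem loopAt_reflect (ρ : Fin P.d) (U : GaugeField P j G) (γ : List (LStep P j)) :
    loopAt (U.reflect ρ) γ = loopAt U (γ.map (LStep.reflect ρ)) := by
  rw [loopAt, loopAt, holAt_reflect]

/-- The same for the loop variable (translations). [folklore] -/
theorem loopAt_translate (a : Site P j) (U : GaugeField P j G) (γ : List (LStep P j)) :
    loopAt (U.translate a) γ = loopAt U (γ.map (LStep.translate a)) := by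
  rw [loopAt, loopAt, holAt_translate]

/-- ITERATED AVERAGING COMMUTES WITH TRANSLATIONS ACROSS LEVELS when each averaging map intertwines the coarse translation by `a`
with the fine translation by `L·a`: `avg^k (U ∘ τ_{L^k b}) = (avg^k U) ∘ τ_b`. [folklore] -/
theorem iter_translate (av : ∀ j, Averaging P j G)
    (h : ∀ (j : ℕ) (a : Site P (j+1)) (U : GaugeField P j G),
      (av j).avg (U.translate (Site.scale a)) = ((av j).avg U).translate a) :
    ∀ (k : ℕ) (b : Site P k) (U : GaugeField P 0 G),
      Averaging.iter av k (U.translate (Site.scaleTo k b)) = (Averaging.iter av k U).translate b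
  | 0, _, _ => rfl
  | k + 1, b, U => by
    show (av k).avg (Averaging.iter av k (U.translate (Site.scaleTo (k+1) b))) =
      ((av k).avg (Averaging.iter av k U)).translate b
    rw [Site.scaleTo_succ, iter_translate av h k (Site.scale b) U, h]

/-- ITERATED AVERAGING COMMUTES WITH THE CENTRE REFLECTIONS when each averaging map does. [folklore] -/
theorem iter_creflect (av : ∀ j, Averaging P j G) (ρ : Fin P.d)
    (h : ∀ (j : ℕ) (U : GaugeField P j G), (av j).avg (U.creflect ρ) = ((av j).avg U).creflect ρ) :
    ∀ (k : ℕ) (U : GaugeField P 0 G), Averaging.iter av k (U.creflect ρ) = (Averaging.iter av k U).creflect ρ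
  | 0, _ => rfl
  | k + 1, U => by
    show (av k).avg (Averaging.iter av k (U.creflect ρ)) = ((av k).avg (Averaging.iter av k U)).creflect ρ
    rw [iter_creflect av ρ h k U, h]

end WalkLemmas

/-! ## 2. Labels: transport of the base to level `K` under reflections and translations -/

namespace T4Family

/-- `toLevel` commutes with axis reflections (coordinatewise ring isomorphism, `map_neg`). [folklore] -/
theorem toLevel_reflect (F : T4Family) (K : ℕ) (ρ : Fin 4) (x : F.USite) :
    F.toLevel K (Site.reflect ρ x) = Site.reflect ρ (F.toLevel K x) := by
  show ⇑(F.siteEquiv K) ∘ Function.update x ρ (-x ρ) = Function.update (⇑(F.siteEquiv K) ∘ x) ρ (-(F.siteEquiv K (x ρ)))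
  rw [Function.comp_update, map_neg]

end T4Family

namespace UWord

variable {F : T4Family}

/-- The representative of a reflected label is the reflected representative. [folklore] -/
theorem atLevel_reflect (K : ℕ) (ρ : Fin 4) (C : UWord F) :
    (C.reflect ρ).atLevel K = (C.atLevel K).map (LStep.reflect ρ) := by
  show walk (F.toLevel K (Site.reflect ρ C.base)) (C.word.map (Letter.reflect ρ)) = _
  rw [F.toLevel_reflect]
  exact walk_reflect ρ (F.toLevel K C.base) C.word

/-- The representative of a translated label is the representative translated by the transported vector. [folklore] -/
theorem atLevel_translate (K : ℕ) (a : F.USite) (C : UWord F) :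
    (C.translate a).atLevel K = (C.atLevel K).map (LStep.translate (F.toLevel K a)) := by
  show walk (F.toLevel K (C.base + a)) C.word = _
  rw [F.toLevel_add]
  exact walk_translate (F.toLevel K a) (F.toLevel K C.base) C.word

end UWord

/-! ## 3. The translation and reflection thirds of `LimitPointsCovariant`, under named intertwining hypotheses -/

namespace FiniteEpsData

variable {F : T4Family} {G : Type*} [GaugeGroup G] [MeasurableSpace G] [HaarData G]

/-- HYPOTHESIS (named, never asserted): the averaging maps intertwine the translations of the coarse torus `T^{(j+1)}` by `a` with
the translations of the fine torus `T^{(j)}` by the fine vector `L·a` (`Site.scale a`), at every level of every approximation —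
the translation instance of [Balaban1987RG1] (2.17) p. 269 "consider a Euclidean symmetry r of the torus T_ζ preserving the torus
T^{(k+1)}. We define generally (rU)(b) = U(rb) … By their definitions the expressions in (2.1) are invariant with respect to these
transformations" (to be read off the printed formulas (0.4)–(0.12) for the total extension an instance module names, cell rows
COV1.X / D.L, GAPS G-t4-COV1-1, -4; it HOLDS for the tree's axial averaging at every level, `AveragingRT.axial_avg_translate`). [cite: Balaban1987RG1, (2.17) p.269] -/
def AvgTranslEquivariant (D : FiniteEpsData F G) : Prop :=
  ∀ (K j : ℕ) (a : Site (F.P K) (j+1)) (U : GaugeField (F.P K) j G),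
    (D.av K j).avg (U.translate (Site.scale a)) = ((D.av K j).avg U).translate a

/-- HYPOTHESIS (named, never asserted): the averaging maps commute with the CENTRE reflections `x_ρ ↦ -x_ρ - 1` (in the centred
labels of every level: the reflections through the centre hyperplanes of the continuum torus, which preserve every `T^{(j)}`;
pull-back `GaugeField.creflect`), at every level of every approximation — the reflection instance of [Balaban1987RG1] (2.17)
p. 269 for the reflections `x_ρ ↦ C_j - x_ρ`, `C_j = L·C_{j+1} + (L-1)`, preserving the block tower (GAPS G-t4-COV1-3 (a)), in
the level-uniform representative `C_j = -1` (cell rows COV1.X / D.L; it HOLDS for the tree's axial averaging at every level and for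
every group, `AveragingRT.axial_avg_creflect` — so it is not vacuous; the naive variant with the site reflection `x_ρ ↦ -x_ρ` at both
levels is false for block averagings with centred blocks, contradicts `Averaging.covariant` for non-trivial `G` (OBJECTION O-COV1-1),
and is NOT this hypothesis). [cite: Balaban1987RG1, (2.17) p.269] -/
def AvgReflEquivariant (D : FiniteEpsData F G) : Prop :=
  ∀ (K j : ℕ) (ρ : Fin 4) (U : GaugeField (F.P K) j G),
    (D.av K j).avg (U.creflect ρ) = ((D.av K j).avg U).creflect ρ

/-- Relabelling by a unit translation `a ∈ T₁` = pulling the fine configuration back by the fine vector `L^K·a`, on averaged loop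
variables, given `AvgTranslEquivariant` (`iter_translate`, `UWord.atLevel_translate`, `loopAt_translate`). [folklore] -/
theorem avgObs_translate (D : FiniteEpsData F G) (htr : D.AvgTranslEquivariant) (K : ℕ) (a : F.USite) (C : ULoop F)
    (U : GaugeField (F.P K) 0 G) :
    D.avgObs K (C.translate a) U = D.avgObs K C (U.translate (Site.scaleTo K (F.toLevel K a))) := by
  show loopAt (Averaging.iter (D.av K) K U) ((C.1.translate a).atLevel K) =
    loopAt (Averaging.iter (D.av K) K (U.translate (Site.scaleTo K (F.toLevel K a)))) (C.1.atLevel K)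
  rw [UWord.atLevel_translate, ← loopAt_translate, iter_translate (D.av K) (fun j a U => htr K j a U) K]

/-- Relabelling by the axis reflection `x_ρ ↦ -x_ρ` of `T₁` = pulling the fine configuration back by the exact symmetry
`U ↦ c_ρ (U ∘ τ_{L^K e_ρ})` (centre reflection after the unit translation), on averaged loop variables, given BOTH hypotheses
(`iter_creflect`, `iter_translate`, `GaugeField.creflect_translate_shift`, `UWord.atLevel_reflect`, `loopAt_reflect`). [folklore] -/
theorem avgObs_reflect (D : FiniteEpsData F G) (htr : D.AvgTranslEquivariant) (hre : D.AvgReflEquivariant) (K : ℕ)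
    (ρ : Fin 4) (C : ULoop F) (U : GaugeField (F.P K) 0 G) :
    D.avgObs K (C.reflect ρ) U =
      D.avgObs K C ((U.translate (Site.scaleTo K ((0 : Site (F.P K) K).shift ρ))).creflect ρ) := by
  show loopAt (Averaging.iter (D.av K) K U) ((C.1.reflect ρ).atLevel K) =
    loopAt (Averaging.iter (D.av K) K ((U.translate (Site.scaleTo K ((0 : Site (F.P K) K).shift ρ))).creflect ρ))
      (C.1.atLevel K)
  rw [UWord.atLevel_reflect, ← loopAt_reflect, iter_creflect (D.av K) ρ (fun j U => hre K j ρ U) K,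
    iter_translate (D.av K) (fun j a U => htr K j a U) K, GaugeField.creflect_translate_shift]

/-- **TRANSLATION COVARIANCE OF THE LIMIT POINTS ON THE CLASS, PROVED under `AvgTranslEquivariant`**: every subsequential limit
functional is invariant under relabelling by the lattice translations `(ℤ/ℓℤ)⁴` of `T₁` — at every `K` the relabelled observable
IS the observable of the translated configuration (`avgObs_translate`) and lattice translations are exact symmetries of the torus
expectation (tree `TorusScheme.limit_translate_invariant`).  No hypothesis on the couplings. [cite: Douglas2004ClayYM, p.2] -/
theorem avg_limitPoints_translate_invariant (D : FiniteEpsData F G) (htr : D.AvgTranslEquivariant) (g₀ : ℕ → ℝ)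
    (a : F.USite) {φ : ℕ → ℕ} {E : List (ULoop F) → ℝ}
    (hE : IsLimitFunctional (fun K => (D.scheme g₀).expectAt (φ K)) E) (Cs : List (ULoop F)) :
    E (Cs.map (ULoop.translate a)) = E Cs :=
  (D.scheme g₀).limit_translate_invariant (ULoop.translate a)
    (fun K => ⟨Site.scaleTo K (F.toLevel K a), fun C => funext fun U => D.avgObs_translate htr K a C U⟩) hE Cs

/-- **REFLECTION COVARIANCE OF THE LIMIT POINTS ON THE CLASS, PROVED under `AvgTranslEquivariant ∧ AvgReflEquivariant`** (compact
group with measurable inversion): every subsequential limit functional is invariant under relabelling by the axis reflections of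
`T₁` — at every `K` the relabelled observable IS the observable of the configuration pulled back by an exact symmetry of the torus
expectation (`avgObs_reflect`, `IsExpectSymmetry.creflect_translate`, tree `TorusScheme.limit_symmetry_invariant`).  No
hypothesis on the couplings. [cite: Douglas2004ClayYM, p.2] -/
theorem avg_limitPoints_reflect_invariant [MeasurableInv G] (D : FiniteEpsData F G) (htr : D.AvgTranslEquivariant)
    (hre : D.AvgReflEquivariant) (g₀ : ℕ → ℝ) (ρ : Fin 4) {φ : ℕ → ℕ} {E : List (ULoop F) → ℝ}
    (hE : IsLimitFunctional (fun K => (D.scheme g₀).expectAt (φ K)) E) (Cs : List (ULoop F)) :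
    E (Cs.map (ULoop.reflect ρ)) = E Cs :=
  (D.scheme g₀).limit_symmetry_invariant (ULoop.reflect ρ)
    (fun K => ⟨fun U => (U.translate (Site.scaleTo K ((0 : Site (F.P K) K).shift ρ))).creflect ρ,
      IsExpectSymmetry.creflect_translate (F.P K) _ ρ _,
      fun C => funext fun U => D.avgObs_reflect htr hre K ρ C U⟩) hE Cs

/-- **TORUS COVARIANCE OF THE LIMIT POINTS ON THE CLASS, PROVED under the three named intertwining hypotheses** (`AvgPermEquivariant`
of `T4Continuum` for the `S₄` third, `avg_limitPoints_permute_invariant`; `AvgTranslEquivariant`; `AvgReflEquivariant`): for EVERY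
bare-coupling sequence, every subsequential limit functional is invariant under the whole isometry group `(ℤ/ℓℤ)⁴ ⋊ B₄` of the unit
torus acting on labels. [cite: Douglas2004ClayYM, p.2] -/
theorem avg_limitPointsCovariant [MeasurableInv G] (D : FiniteEpsData F G) (hperm : D.AvgPermEquivariant)
    (htr : D.AvgTranslEquivariant) (hre : D.AvgReflEquivariant) (g₀ : ℕ → ℝ) :
    LimitPointsCovariant F (D.scheme g₀) := fun _ _ _ hE =>
  ⟨fun a Cs => D.avg_limitPoints_translate_invariant htr g₀ a hE Cs,
    fun π Cs => D.avg_limitPoints_permute_invariant hperm g₀ π hE Cs,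
    fun ρ Cs => D.avg_limitPoints_reflect_invariant htr hre g₀ ρ hE Cs⟩

/-- Hence **`limit_torusCovariant'` and `limit_torusCovariant` HOLD under the three named intertwining hypotheses** (the quantifier
prefix over (B), the β-hypothesis and the tuning is discharged trivially because the conclusion needs no hypothesis on the
couplings) — the torus-covariance clause of the typed rung (B)+1 is thereby reduced to the cell's reading row COV1.X (that
Bałaban's averaging (0.4)–(0.12) of [Balaban1987RG1] satisfies the three printed-formula identities). [folklore] -/
theorem avg_limit_torusCovariant [MeasurableInv G] (D : FiniteEpsData F G) (hperm : D.AvgPermEquivariant)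
    (htr : D.AvgTranslEquivariant) (hre : D.AvgReflEquivariant) :
    D.limit_torusCovariant' ∧ D.limit_torusCovariant :=
  ⟨fun _ _ => ⟨1, one_pos, fun _ _ _ => ⟨1, one_pos, fun _ _ _ g₀ _ => D.avg_limitPointsCovariant hperm htr hre g₀⟩⟩,
    fun _ _ => ⟨1, one_pos, fun _ _ _ => ⟨1, one_pos, fun _ _ _ g₀ _ => D.avg_limitPointsCovariant hperm htr hre g₀⟩⟩⟩

end FiniteEpsData

/-- **REDUCTION of the `SU(2)` headline of `T4Continuum` §8 (print-faithful form) to ONE target, given measurable and equivariant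
averagings**: EXISTENCE of the full-sequence limit implies the conjunction of the four targets (existence ⇒ uniqueness,
`T4Continuum.limit_unique'_of_limit_exists'`; RP proved for `SU(N)`, `T4Continuum.avg_limit_reflectionPositive_SU`; torus
covariance proved here, `avg_limit_torusCovariant`).  What remains of rung (B)+1 on the class is exactly
`ym4_torus_continuum_limit_exists'` — and the four printed-formula properties of Bałaban's averaging (`AvgMeasurable`,
`AvgPermEquivariant`, `AvgTranslEquivariant`, `AvgReflEquivariant`; cell rows O1.X, COV1.X). [folklore] -/
theorem ym4TorusContinuumSU2'_of_exists
    (h : ∀ (F : T4Family) (D : FiniteEpsData F (Matrix.specialUnitaryGroup (Fin 2) ℂ)),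
      D.AvgMeasurable ∧ D.AvgPermEquivariant ∧ D.AvgTranslEquivariant ∧ D.AvgReflEquivariant ∧
        D.ym4_torus_continuum_limit_exists') :
    YM4TorusContinuumSU2' :=
  ym4TorusContinuumSU2'_of_exists_covariant fun F D =>
    ⟨(h F D).1, (h F D).2.2.2.2, (D.avg_limit_torusCovariant (h F D).2.1 (h F D).2.2.1 (h F D).2.2.2.1).1⟩

end T4Continuum

/-! ## 4. Consistency certificates: the tree's axial block averaging satisfies both hypothesis shapes at every level -/

namespace AveragingRT

section Certificates

variable {P : Params} {j : ℕ}

/-- The straight line of a translated coarse bond is the translated straight line (fine vector `L·a`; `Site.emb_add`). [folklore] -/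
theorem lineSite_translate (c : PBond P (j+1)) (a : Site P (j+1)) (t : ℕ) :
    lineSite (c.translate a) t = lineSite c t + Site.scale a := by
  funext ν
  show Function.update (emb (c.src + a)) c.dir (emb (c.src + a) c.dir + t) ν =
    Function.update (emb c.src) c.dir (emb c.src c.dir + t) ν + Site.scale a ν
  rw [Site.emb_add]
  by_cases h : ν = c.dir
  · rw [h]
    simp only [Function.update_self, Site.add_apply]
    ring
  · simp only [Function.update_of_ne h, Site.add_apply]

/-- The same on bonds. [folklore] -/
theorem line_translate (c : PBond P (j+1)) (a : Site P (j+1)) (t : ℕ) :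
    line (c.translate a) t = (line c t).translate (Site.scale a) := by
  show (⟨lineSite (c.translate a) t, c.dir⟩ : PBond P j) = ⟨lineSite c t + Site.scale a, c.dir⟩
  rw [lineSite_translate]

variable {G : Type*} [GaugeGroup G]

/-- Parallel transport along the line of `c` in the configuration translated by `L·a` = parallel transport along the line of
`c + a`. [folklore] -/
theorem pathProd_translate (U : GaugeField P j G) (c : PBond P (j+1)) (a : Site P (j+1)) :
    ∀ n, pathProd (U.translate (Site.scale a)) c n = pathProd U (c.translate a) n
  | 0 => rfl
  | n + 1 => by
    rw [pathProd, pathProd, pathProd_translate U c a n, GaugeField.translate_apply, line_translate]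

/-- **CERTIFICATE (translations)**: the tree's axial block averaging ([Balaban1984PropagatorsI] (1.7): the parallel transporter along
the straight line of `L` fine bonds from block centre to block centre) satisfies the shape `AvgTranslEquivariant` at every level:
`axialAvg (U ∘ τ_{L a}) = (axialAvg U) ∘ τ_a`. [folklore] -/
theorem axialAvg_translate (U : GaugeField P j G) (a : Site P (j+1)) :
    axialAvg (U.translate (Site.scale a)) = (axialAvg U).translate a := by
  funext c
  exact pathProd_translate U c a P.L

/-- The coarse bond whose straight line is the centre-reflected straight line of `c`: `c` reflected by `x_ρ ↦ -x_ρ - 1` (as a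
positively oriented bond: `PBond.reflect` followed by the translation by `-e_ρ`). [folklore] -/
def crefBond (ρ : Fin P.d) (c : PBond P (j+1)) : PBond P (j+1) :=
  (c.reflect ρ).translate ((0 : Site P (j+1)).unshift ρ)

/-- Direction of `crefBond`. [folklore] -/
theorem crefBond_dir (ρ : Fin P.d) (c : PBond P (j+1)) : (crefBond ρ c).dir = c.dir := rfl

/-- Source of `crefBond`, transverse case. [folklore] -/
theorem crefBond_src_of_ne (ρ : Fin P.d) (c : PBond P (j+1)) (h : c.dir ≠ ρ) :
    (crefBond ρ c).src = (c.src.reflect ρ).unshift ρ := by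
  show (c.reflect ρ).src + (0 : Site P (j+1)).unshift ρ = _
  rw [PBond.reflect_src_of_ne ρ c h, Site.add_zero_unshift]

/-- Source of `crefBond`, longitudinal case. [folklore] -/
theorem crefBond_src_of_eq (ρ : Fin P.d) (c : PBond P (j+1)) (h : c.dir = ρ) :
    (crefBond ρ c).src = ((c.src.shift ρ).reflect ρ).unshift ρ := by
  show (c.reflect ρ).src + (0 : Site P (j+1)).unshift ρ = _
  rw [PBond.reflect_src_of_eq ρ c h, Site.add_zero_unshift]

/-- Transverse case (`c.dir ≠ ρ`): the centre reflection maps the `t`-th line site of `c` to the `t`-th line site of `crefBond ρ c`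
— the `ρ`-coordinate identity `-(L y_ρ + (L-1)/2) - 1 = L(-y_ρ - 1) + (L-1)/2` is `2·((L-1)/2) + 1 = L`. [folklore] -/
theorem lineSite_creflect_of_ne (ρ : Fin P.d) (c : PBond P (j+1)) (h : c.dir ≠ ρ) (t : ℕ) :
    ((lineSite c t).reflect ρ).unshift ρ = lineSite (crefBond ρ c) t := by
  have hL := Site.two_mul_half_add_one_cast P j
  funext κ
  simp only [Site.unshift, Site.reflect, lineSite, crefBond_dir, crefBond_src_of_ne ρ c h, Function.update_self,
    Function.update_idem]
  by_cases h1 : κ = ρ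
  · subst h1
    simp only [Function.update_self, Function.update_of_ne (Ne.symm h), Site.emb_apply_eq, map_sub, map_neg,
      Site.scaleCoord_one]
    linear_combination -hL
  · rcases eq_or_ne κ c.dir with h2 | h2
    · rw [h2] at h1 ⊢
      simp only [Function.update_self, Function.update_of_ne h1, Site.emb_apply_eq]
    · simp only [Function.update_of_ne h1, Function.update_of_ne h2, Site.emb_apply_eq]

/-- Longitudinal case (`c.dir = ρ`): the centre reflection maps the END of the `t`-th line bond of `c` (`t < L`) to the START of the
`(L-1-t)`-th line bond of `crefBond ρ c` (the reflected line is traversed backwards). [folklore] -/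
theorem lineSite_creflect_of_eq (ρ : Fin P.d) (c : PBond P (j+1)) (h : c.dir = ρ) {t : ℕ} (ht : t < P.L) :
    (((lineSite c t).shift ρ).reflect ρ).unshift ρ = lineSite (crefBond ρ c) (P.L - 1 - t) := by
  have hL := Site.two_mul_half_add_one_cast P j
  have ht' : ((P.L - 1 - t : ℕ) : ZMod (P.sitesPerDir j)) = (P.L : ZMod (P.sitesPerDir j)) - 1 - t := by
    have h1 : P.L - 1 - t + t + 1 = P.L := by omega
    have h2 := congrArg (Nat.cast : ℕ → ZMod (P.sitesPerDir j)) h1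
    push_cast at h2
    linear_combination h2
  have hsrc := crefBond_src_of_eq ρ c h
  subst h
  funext κ
  simp only [Site.unshift, Site.reflect, Site.shift, lineSite, crefBond_dir, hsrc, Function.update_self, Function.update_idem]
  rcases eq_or_ne κ c.dir with h2 | h2
  · rw [h2]
    simp only [Function.update_self, Site.emb_apply_eq, map_sub, map_neg, map_add, Site.scaleCoord_one]
    linear_combination -hL - ht'
  · simp only [Function.update_of_ne h2, Site.emb_apply_eq]

/-- Transverse case on bonds: the pull-back bond of the `t`-th line bond of `c` under the centre reflection is the `t`-th line bond
of `crefBond ρ c`. [folklore] -/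
theorem line_creflect_of_ne (ρ : Fin P.d) (c : PBond P (j+1)) (h : c.dir ≠ ρ) (t : ℕ) :
    ((line c t).reflect ρ).translate ((0 : Site P j).unshift ρ) = line (crefBond ρ c) t := by
  show (⟨((line c t).reflect ρ).src + (0 : Site P j).unshift ρ, c.dir⟩ : PBond P j) = ⟨lineSite (crefBond ρ c) t, c.dir⟩
  rw [PBond.reflect_src_of_ne ρ (line c t) h, Site.add_zero_unshift]
  show (⟨((lineSite c t).reflect ρ).unshift ρ, c.dir⟩ : PBond P j) = _
  rw [lineSite_creflect_of_ne ρ c h t]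

/-- Longitudinal case on bonds: the pull-back bond of the `t`-th line bond of `c` (`t < L`) under the centre reflection is the
`(L-1-t)`-th line bond of `crefBond ρ c`. [folklore] -/
theorem line_creflect_of_eq (ρ : Fin P.d) (c : PBond P (j+1)) (h : c.dir = ρ) {t : ℕ} (ht : t < P.L) :
    ((line c t).reflect ρ).translate ((0 : Site P j).unshift ρ) = line (crefBond ρ c) (P.L - 1 - t) := by
  show (⟨((line c t).reflect ρ).src + (0 : Site P j).unshift ρ, c.dir⟩ : PBond P j) =
    ⟨lineSite (crefBond ρ c) (P.L - 1 - t), c.dir⟩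
  rw [PBond.reflect_src_of_eq ρ (line c t) h, Site.add_zero_unshift]
  show (⟨(((lineSite c t).shift ρ).reflect ρ).unshift ρ, c.dir⟩ : PBond P j) = _
  rw [lineSite_creflect_of_eq ρ c h ht]

/-- `pathProd` as a list product over `range n`. [folklore] -/
theorem pathProd_eq_prod_range (U : GaugeField P j G) (c : PBond P (j+1)) :
    ∀ n, pathProd U c n = ((List.range n).map fun t => U (line c t)).prod
  | 0 => by simp [pathProd]
  | n + 1 => by
    rw [pathProd, pathProd_eq_prod_range U c n, List.range_succ, List.map_append, List.prod_append, List.map_singleton,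
      List.prod_singleton]

/-- A reversed product of inverses is the inverse of the product. [folklore] -/
theorem prod_range_reverse_inv {M : Type*} [Group M] (n : ℕ) (f : ℕ → M) :
    ((List.range n).map fun t => (f (n - 1 - t))⁻¹).prod = (((List.range n).map f).prod)⁻¹ := by
  rw [List.prod_inv_reverse, List.map_map, ← List.map_reverse, List.range_eq_range', List.reverse_range', List.map_map,
    ← List.range_eq_range']
  apply congrArg
  apply List.map_congr_left
  intro t _
  simp

/-- Transverse bonds: parallel transport along the line of `c` in the centre-reflected configuration = parallel transport along the
line of `crefBond ρ c`. [folklore] -/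
theorem pathProd_creflect_of_ne (ρ : Fin P.d) (U : GaugeField P j G) (c : PBond P (j+1)) (h : c.dir ≠ ρ) :
    ∀ n, pathProd (U.creflect ρ) c n = pathProd U (crefBond ρ c) n
  | 0 => rfl
  | n + 1 => by
    rw [pathProd, pathProd, pathProd_creflect_of_ne ρ U c h n]
    congr 1
    have hd : (line c n).dir ≠ ρ := h
    rw [GaugeField.creflect_eq, GaugeField.reflect_apply, if_neg hd, GaugeField.translate_apply, line_creflect_of_ne ρ c h n]

/-- Longitudinal bonds: parallel transport along the first `n ≤ L` bonds of the line of `c` in the centre-reflected configuration =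
the product of the INVERSES of the transporters along the bonds `L-1, L-2, …, L-n` of the line of `crefBond ρ c`. [folklore] -/
theorem pathProd_creflect_of_eq (ρ : Fin P.d) (U : GaugeField P j G) (c : PBond P (j+1)) (h : c.dir = ρ) :
    ∀ n, n ≤ P.L → pathProd (U.creflect ρ) c n = ((List.range n).map fun t => (U (line (crefBond ρ c) (P.L - 1 - t)))⁻¹).prod
  | 0, _ => by simp [pathProd]
  | n + 1, hn => by
    rw [pathProd, pathProd_creflect_of_eq ρ U c h n (Nat.le_of_succ_le hn), List.range_succ, List.map_append, List.prod_append,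
      List.map_singleton, List.prod_singleton]
    congr 1
    have hd : (line c n).dir = ρ := h
    rw [GaugeField.creflect_eq, GaugeField.reflect_apply, if_pos hd, GaugeField.translate_apply,
      line_creflect_of_eq ρ c h (Nat.lt_of_succ_le hn)]

/-- **CERTIFICATE (reflections)**: the tree's axial block averaging satisfies the shape `AvgReflEquivariant` at every level:
`axialAvg (c_ρ U) = c_ρ (axialAvg U)` for the CENTRE reflection `c_ρ` (`GaugeField.creflect`) — transversally line by line,
longitudinally because the reflected line is the line of the reflected bond traversed backwards (`List.prod_inv_reverse`).  (With
the site reflection `x_ρ ↦ -x_ρ` in place of `c_ρ` the identity is false: the reflected line starts at `-emb(c₋) = emb(-c₋-1)`.) [folklore] -/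
theorem axialAvg_creflect (ρ : Fin P.d) (U : GaugeField P j G) :
    axialAvg (U.creflect ρ) = (axialAvg U).creflect ρ := by
  funext c
  show axialAvg (U.creflect ρ) c = ((axialAvg U).translate ((0 : Site P (j+1)).unshift ρ)).reflect ρ c
  rw [GaugeField.reflect_apply]
  by_cases h : c.dir = ρ
  · rw [if_pos h, GaugeField.translate_apply]
    show pathProd (U.creflect ρ) c P.L = (pathProd U (crefBond ρ c) P.L)⁻¹
    rw [pathProd_creflect_of_eq ρ U c h P.L le_rfl, pathProd_eq_prod_range]
    exact prod_range_reverse_inv P.L fun t => U (line (crefBond ρ c) t)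
  · rw [if_neg h, GaugeField.translate_apply]
    exact pathProd_creflect_of_ne ρ U c h P.L

/-- The axial averaging, as the tree's `Averaging` structure, satisfies the translation shape. [folklore] -/
theorem axial_avg_translate (U : GaugeField P j G) (a : Site P (j+1)) :
    (axial : Averaging P j G).avg (U.translate (Site.scale a)) = ((axial : Averaging P j G).avg U).translate a := by
  simp only [axial_avg]
  exact axialAvg_translate U a

/-- The axial averaging, as the tree's `Averaging` structure, satisfies the reflection shape. [folklore] -/
theorem axial_avg_creflect (ρ : Fin P.d) (U : GaugeField P j G) :
    (axial : Averaging P j G).avg (U.creflect ρ) = ((axial : Averaging P j G).avg U).creflect ρ := by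
  simp only [axial_avg]
  exact axialAvg_creflect ρ U

end Certificates

end AveragingRT

end Literature.MathematicalPhysics.QuantumFieldTheory.Balaban1983to89
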